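import Literature.Probability.Percolation.SlabRSWGluingCrossRoute
import Literature.Probability.Percolation.SlabRSWGluingExtB
import HarnessLib

/-!
# Newman–Tassion–Wu 2017, §3.2/§3.5 — routes with a PORT CHAIN: the branch leaves the free region
# through cleared tiles

Topic: `Literature/Probability/Percolation`. Routing layer for the local surgery of the coarse-grained
gluing datum (`SlabRSWSnapDatum/Frame/Layout.lean`). In that geometry the rerouted minimal path (the
trunk) lives in a free rectangle or L-shape `K`, while the far path may arrive — and the cleared set
extends — into the neighbouring TILES (cells of `N(Γ) ∪ τN(Γ)`, all closed by the surgery); the branch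
then consists of a route inside `K` to an ENTRY cell followed by a lattice chain through the tiles to
the port (NTW's "γ_w", DST's third path, continued outside the routing box exactly as in the tree's
`exists_surgeryB_ext`, whose exterior `L`-path this generalises). This file is geometry-free in `K`:

* `RouteSpec.append_lift` — append the lift (at one height) of a planar self-avoiding path to the
  branch of a route;
* `exists_route_port` — a route in `K` (any region with a router `hroute`, e.g. `exists_route` for a
  `3 × 4` rectangle, `exists_route_cross` for a cross) from `E₁` to `E₂` with branch to a target `w'`
  that is either over `K` or reached from an entry cell of `K` by a planar chain off `K`;
* `exists_routeB_port` — the same with the trunk ENDING one step outside `K` at a target cell (the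
  `SurgeryB` shape), given TWO candidate (entry-side cell, target cell) pairs with distinct `K`-cells —
  one pair is not enough (with `k = 1`, `E₁` over the unique neighbour of the target cell at height `1`
  and the port over the target cell at height `0`, no admissible trunk/branch exists).

## Sources

* C. M. Newman, V. Tassion, W. Wu, *Critical percolation and the minimal spanning tree in slabs*,
  Comm. Pure Appl. Math. 70 (2017), arXiv:1512.09107: §3.2, proof of Theorem 3.7, steps (1)–(3)
  (the three paths `γ_u, γ_v, γ_w`); §3.5, proof of Lemma 3.16 [NewmanTassionWu2017].
* H. Duminil-Copin, V. Sidoravicius, V. Tassion, *Absence of infinite cluster for critical Bernoulli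
  percolation on slabs*, CPAM 69 (2016), §2.3, proof of Fact 2 (the routing box) — the tree's
  `exists_route`.
-/

noncomputable section

namespace Literature.Probability.Percolation

open MeasureTheory LatticeModels SimpleGraph

namespace NTW17

variable {k : ℕ}

/-! ## Appending a lifted planar chain to the branch -/

section Lift

variable {RP Db : Set (ℤ × ℤ)} {E₁ E₂ c : slab 3 k} {L Br : List (slab 3 k)}

/-- **Appending the lift of a planar self-avoiding path to the branch of a route**: the route ends its
branch at `vtx e h`; `l` is a planar self-avoiding path from a neighbour `m` of `e` to `t` whose cells
lie in the branch region, and no trunk or branch vertex AT HEIGHT `h` has its cell on `l`; the result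
is a route with branch end `vtx t h`. [cite: NewmanTassionWu2017, §3.2 (proof of Theorem 3.7, step (3), the path γ_w)] -/
theorem RouteSpec.append_lift {e m t : ℤ × ℤ} {h : ℕ} (hh : h ≤ k)
    (spec : RouteSpec k RP Db E₁ E₂ (vtx k e h) L Br c) (hem : planarAdj e m) {l : List (ℤ × ℤ)}
    (hl : PPath l m t) (hlD : ∀ z ∈ l, z ∈ Db) (hlL : ∀ v ∈ L, planar k v ∈ l → ht v ≠ h)
    (hlBr : ∀ v ∈ c :: Br, planar k v ∈ l → ht v ≠ h) :
    ∃ Br', RouteSpec k RP Db E₁ E₂ (vtx k t h) L Br' c := by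
  set X : List (slab 3 k) := liftH k h l with hX
  have hXne : X ≠ [] := liftH_ne_nil hl.ne_nil
  have hmem : ∀ x ∈ X, planar k x ∈ l ∧ ht x = h := fun x hx => (mem_liftH_iff hh x).1 hx
  have hch : (vtx k e h :: X).IsChain (fun a b => (slabGraph 3 k).Adj a b) := by
    obtain ⟨l₀, l', hl₀⟩ := List.exists_cons_of_ne_nil hl.ne_nil
    have hm : l₀ = m := by
      have := hl.head; rw [hl₀] at this; simpa using this
    subst hm
    rw [hX, hl₀, liftH, List.map_cons, List.isChain_cons_cons]
    refine ⟨vtx_adj_vtx_planar hem h, ?_⟩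
    have := liftH_isChain (k := k) h hl.chain
    rw [hl₀, liftH, List.map_cons] at this
    exact this
  have spec' := RouteSpec.append_branch X (vtx k e h) Br hXne spec hch (liftH_nodup hl.nodup)
    (fun x hx hxL => hlL x hxL (hmem x hx).1 (hmem x hx).2) (fun x hx hxB => hlBr x hxB (hmem x hx).1 (hmem x hx).2)
    (fun x hx => hlD _ (hmem x hx).1)
  have hlast : X.getLast hXne = vtx k t h := by
    apply Option.some.inj
    rw [← List.getLast?_eq_some_getLast, hX, getLast?_liftH, hl.last, Option.map_some]
  rw [hlast] at spec'
  exact ⟨_, spec'⟩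

end Lift

/-! ## Routes with a port chain -/

section Port

variable {K Db : Set (ℤ × ℤ)}

/-- **Route with a port chain.** `K` is a region with a router (`hroute`: any two distinct vertices
over `K` and any target over `K` off their cells admit a route inside `K`), `K ⊆ Db`. For `E₁ ≠ E₂`
over `K` and a target `w'` off the cells of `E₁, E₂` such that, if `w'` is not over `K`,
some entry cell `e ∈ K` avoiding any two prescribed cells has a neighbour `m` from which a planar
self-avoiding path inside `Db ∖ K` reaches the cell of `w'`: there is a route with trunk in `K`, branch
in `Db`, ending at `w'`. [cite: NewmanTassionWu2017, §3.2 (proof of Theorem 3.7, steps (1)–(3)); §3.5 (proof of Lemma 3.16)] -/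
theorem exists_route_port (hKD : K ⊆ Db)
    (hroute : ∀ (E₁ E₂ w : slab 3 k), planar k E₁ ∈ K → planar k E₂ ∈ K → planar k w ∈ K → E₁ ≠ E₂ →
      planar k E₁ ≠ planar k w → planar k E₂ ≠ planar k w → ∃ L Br c, RouteSpec k K K E₁ E₂ w L Br c)
    {E₁ E₂ w' : slab 3 k} (hE₁ : planar k E₁ ∈ K) (hE₂ : planar k E₂ ∈ K) (hne : E₁ ≠ E₂)
    (h1 : planar k E₁ ≠ planar k w') (h2 : planar k E₂ ≠ planar k w')
    (hport : planar k w' ∉ K → ∀ f₁ f₂ : ℤ × ℤ, ∃ e m : ℤ × ℤ, e ∈ K ∧ e ≠ f₁ ∧ e ≠ f₂ ∧ planarAdj e m ∧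
      ∃ l : List (ℤ × ℤ), PPath l m (planar k w') ∧ ∀ z ∈ l, z ∈ Db ∧ z ∉ K) :
    ∃ L Br c, RouteSpec k K Db E₁ E₂ w' L Br c := by
  by_cases hin : planar k w' ∈ K
  · obtain ⟨L, Br, c, spec⟩ := hroute E₁ E₂ w' hE₁ hE₂ hin hne h1 h2
    exact ⟨L, Br, c, RouteSpec.mono spec subset_rfl hKD⟩
  obtain ⟨e, m, heK, he₁, he₂, hem, l, hl, hlD⟩ := hport hin (planar k E₁) (planar k E₂)
  set h := ht w' with hh
  have hhk : h ≤ k := ht_le w'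
  obtain ⟨L, Br, c, spec₀⟩ := hroute E₁ E₂ (vtx k e h) hE₁ hE₂ (by rw [planar_vtx]; exact heK) hne
    (by rw [planar_vtx]; exact fun h' => he₁ h'.symm) (by rw [planar_vtx]; exact fun h' => he₂ h'.symm)
  have hL : ∀ v ∈ L, planar k v ∈ K := spec₀.hL_sub
  have hBr : ∀ v ∈ Br, planar k v ∈ K := spec₀.hBr_sub
  have hcK : planar k c ∈ K := hL c spec₀.hc
  have spec₁ : RouteSpec k K Db E₁ E₂ (vtx k e h) L Br c := RouteSpec.mono spec₀ subset_rfl hKD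
  obtain ⟨Br', spec₂⟩ := RouteSpec.append_lift hhk spec₁ hem hl (fun z hz => (hlD z hz).1)
    (fun v hv hvl _ => (hlD _ hvl).2 (hL v hv))
    (fun v hv hvl _ => by
      rcases List.mem_cons.1 hv with rfl | hv
      · exact (hlD _ hvl).2 hcK
      · exact (hlD _ hvl).2 (hBr v hv))
  rw [hh, vtx_planar_ht] at spec₂
  exact ⟨L, Br', c, spec₂⟩

/-- Two heights in a slab of thickness `k ≥ 1`: a height `≤ k` different from a given one.
[cite: NewmanTassionWu2017, §3.2 (proof of Theorem 3.7: "k is assumed to be strictly larger than 0")] -/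
theorem exists_height_ne (hk : 1 ≤ k) (h₀ : ℕ) : ∃ h : ℕ, h ≤ k ∧ h ≠ h₀ :=
  if hz : h₀ = 0 then ⟨1, hk, by omega⟩ else ⟨0, Nat.zero_le _, fun h => hz h.symm⟩

/-- **Route ending one step outside `K`, with a port chain** (the `SurgeryB` shape). Besides the data
of `exists_route_port` (for `E₁` and the target `w'` only), two pairs `(bᵢ, tᵢ)` of a cell `bᵢ ∈ K`
and an adjacent cell `tᵢ ∈ Db ∖ K` with `b₁ ≠ b₂` are given (`k ≥ 1`). Then for one of the two target
cells `t` and some height `hβ ≤ k` there is a route in `Db` from `E₁` to `β = vtx t hβ` with branch to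
`w'`, all of whose trunk vertices other than `E₁` and `β` lie over `K`.
[cite: NewmanTassionWu2017, §3.2 (proof of Theorem 3.7, steps (1)–(3): "if z = v we take v = v′ = z"); §3.5 (proof of Lemma 3.16)] -/
theorem exists_routeB_port (hk : 1 ≤ k) (hKD : K ⊆ Db)
    (hroute : ∀ (E₁ E₂ w : slab 3 k), planar k E₁ ∈ K → planar k E₂ ∈ K → planar k w ∈ K → E₁ ≠ E₂ →
      planar k E₁ ≠ planar k w → planar k E₂ ≠ planar k w → ∃ L Br c, RouteSpec k K K E₁ E₂ w L Br c)
    {E₁ w' : slab 3 k} (hE₁ : planar k E₁ ∈ K) (h1 : planar k E₁ ≠ planar k w')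
    {b₁ t₁ b₂ t₂ : ℤ × ℤ} (hb₁ : b₁ ∈ K) (hb₂ : b₂ ∈ K) (hb : b₁ ≠ b₂) (ht₁ : t₁ ∈ Db) (ht₁K : t₁ ∉ K)
    (ht₂ : t₂ ∈ Db) (ht₂K : t₂ ∉ K) (hadj₁ : planarAdj b₁ t₁) (hadj₂ : planarAdj b₂ t₂)
    (hport : planar k w' ∉ K → ∀ f₁ f₂ : ℤ × ℤ, ∃ e m : ℤ × ℤ, e ∈ K ∧ e ≠ f₁ ∧ e ≠ f₂ ∧ planarAdj e m ∧
      ∃ l : List (ℤ × ℤ), PPath l m (planar k w') ∧ ∀ z ∈ l, z ∈ Db ∧ z ∉ K) :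
    ∃ (t : ℤ × ℤ) (hβ : ℕ), (t = t₁ ∨ t = t₂) ∧ hβ ≤ k ∧ ∃ L Br c,
      RouteSpec k Db Db E₁ (vtx k t hβ) w' L Br c ∧
      ∀ v ∈ L, v ≠ E₁ → v ≠ vtx k t hβ → planar k v ∈ K := by
  /- choice of the pair: its `K`-cell `b` must differ from the cell of the branch end `w''` used in
  the router (the cell of `w'` if over `K`, else an entry cell which we choose off `b` anyway) and,
  when the height `hβ` is forced (port chain: `hβ ≠ ht w'`), from the cell of `E₁`. -/
  by_cases hin : planar k w' ∈ K
  · -- no chain: pick `b ≠ planar w'`, then `hβ ≠ ht E₁`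
    obtain ⟨b, t, hbt, hbK, htD, htK, hadj, hbw⟩ : ∃ b t : ℤ × ℤ, (t = t₁ ∨ t = t₂) ∧ b ∈ K ∧ t ∈ Db ∧
        t ∉ K ∧ planarAdj b t ∧ b ≠ planar k w' := by
      by_cases hbw : b₁ = planar k w'
      · exact ⟨b₂, t₂, Or.inr rfl, hb₂, ht₂, ht₂K, hadj₂, fun h => hb (hbw.trans h.symm)⟩
      · exact ⟨b₁, t₁, Or.inl rfl, hb₁, ht₁, ht₁K, hadj₁, hbw⟩
    obtain ⟨hβ, hβk, hβE⟩ := exists_height_ne hk (ht E₁)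
    have hneβ' : E₁ ≠ vtx k b hβ := by
      intro h
      have := congrArg ht h
      rw [ht_vtx hβk] at this
      exact hβE this.symm
    obtain ⟨L, Br, c, spec₀⟩ := hroute E₁ (vtx k b hβ) w' hE₁ (by rw [planar_vtx]; exact hbK) hin hneβ' h1
      (by rw [planar_vtx]; exact hbw)
    have hL : ∀ v ∈ L, planar k v ∈ K := spec₀.hL_sub
    have hBr : ∀ v ∈ Br, planar k v ∈ K := spec₀.hBr_sub
    have hβL : vtx k t hβ ∉ L := fun h => htK (by simpa [planar_vtx] using hL _ h)
    have hβBr : vtx k t hβ ∉ Br := fun h => htK (by simpa [planar_vtx] using hBr _ h)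
    have spec₁ := RouteSpec.concat_trunk spec₀ hKD (vtx_adj_vtx_planar hadj hβ) hβL hβBr
      (by rw [planar_vtx]; exact htD)
    have spec₂ : RouteSpec k Db Db E₁ (vtx k t hβ) w' (L ++ [vtx k t hβ]) Br c := RouteSpec.mono spec₁ subset_rfl hKD
    refine ⟨t, hβ, hbt, hβk, _, _, _, spec₂, fun v hv hv₁ hv₂ => ?_⟩
    rcases List.mem_append.1 hv with hv | hv
    · exact hL v hv
    · rw [List.mem_singleton] at hv; exact absurd hv hv₂
  · -- chain at height `ht w'`: `hβ ≠ ht w'`; pick `b ≠ planar E₁`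
    obtain ⟨b, t, hbt, hbK, htD, htK, hadj, hbE⟩ : ∃ b t : ℤ × ℤ, (t = t₁ ∨ t = t₂) ∧ b ∈ K ∧ t ∈ Db ∧
        t ∉ K ∧ planarAdj b t ∧ b ≠ planar k E₁ := by
      by_cases hbE : b₁ = planar k E₁
      · exact ⟨b₂, t₂, Or.inr rfl, hb₂, ht₂, ht₂K, hadj₂, fun h => hb (hbE.trans h.symm)⟩
      · exact ⟨b₁, t₁, Or.inl rfl, hb₁, ht₁, ht₁K, hadj₁, hbE⟩
    set hw := ht w' with hhw
    have hwk : hw ≤ k := ht_le w'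
    obtain ⟨hβ, hβk, hβw⟩ := exists_height_ne hk hw
    obtain ⟨e, m, heK, he₁, he₂, hem, l, hl, hlD⟩ := hport hin (planar k E₁) b
    have hneβ' : E₁ ≠ vtx k b hβ := by
      intro h; apply hbE; have := congrArg (planar k) h; rw [planar_vtx] at this; exact this.symm
    obtain ⟨L, Br, c, spec₀⟩ := hroute E₁ (vtx k b hβ) (vtx k e hw) hE₁ (by rw [planar_vtx]; exact hbK)
      (by rw [planar_vtx]; exact heK) hneβ' (by rw [planar_vtx]; exact fun h' => he₁ h'.symm)
      (by rw [planar_vtx, planar_vtx]; exact fun h' => he₂ h'.symm)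
    have hL : ∀ v ∈ L, planar k v ∈ K := spec₀.hL_sub
    have hBr : ∀ v ∈ Br, planar k v ∈ K := spec₀.hBr_sub
    have hcK : planar k c ∈ K := hL c spec₀.hc
    have hβL : vtx k t hβ ∉ L := fun h => htK (by simpa [planar_vtx] using hL _ h)
    have hβBr : vtx k t hβ ∉ Br := fun h => htK (by simpa [planar_vtx] using hBr _ h)
    have spec₁ := RouteSpec.concat_trunk spec₀ hKD (vtx_adj_vtx_planar hadj hβ) hβL hβBr
      (by rw [planar_vtx]; exact htD)
    have spec₂ : RouteSpec k Db Db E₁ (vtx k t hβ) (vtx k e hw) (L ++ [vtx k t hβ]) Br c :=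
      RouteSpec.mono spec₁ subset_rfl hKD
    obtain ⟨Br', spec₃⟩ := RouteSpec.append_lift hwk spec₂ hem hl (fun z hz => (hlD z hz).1)
      (fun v hv hvl hvh => by
        rcases List.mem_append.1 hv with hv | hv
        · exact (hlD _ hvl).2 (hL v hv)
        · -- the chain runs at height `hw ≠ hβ`, so it misses `β` even if it passes `β`'s cell
          rw [List.mem_singleton] at hv
          rw [hv, ht_vtx hβk] at hvh
          exact hβw hvh)
      (fun v hv hvl _ => by
        rcases List.mem_cons.1 hv with rfl | hv
        · exact (hlD _ hvl).2 hcK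
        · exact (hlD _ hvl).2 (hBr v hv))
    rw [hhw, vtx_planar_ht] at spec₃
    refine ⟨t, hβ, hbt, hβk, _, _, _, spec₃, fun v hv hv₁ hv₂ => ?_⟩
    rcases List.mem_append.1 hv with hv | hv
    · exact hL v hv
    · rw [List.mem_singleton] at hv; exact absurd hv hv₂

end Port

end NTW17

end Literature.Probability.Percolation
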